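import Literature.Computability.Cryptography.LeftoverHashMinEntropy
import Mathlib.Algebra.Order.Chebyshev
import HarnessLib

/-!
# The generalized (average-case, conditional) Leftover Hash Lemma

Companion of `LeftoverHashLemma.lean` (flat sources) and `LeftoverHashMinEntropy.lean` (min-entropy
sources; Arora–Barak 2009, Lemma 21.26). The printed lemma of this file:

> **Dodis–Ostrovsky–Reyzin–Smith 2008, Lemma 2.4 (Generalized Leftover Hash Lemma).** Assume
> `{H_x : {0,1}ⁿ → {0,1}^ℓ}_{x ∈ X}` is a family of universal hash functions. Then, for any random
> variables `W` and `I`, `SD((H_X(W), X, I), (U_ℓ, X, I)) ≤ ½ √(2^{−H̃∞(W|I)} 2^ℓ)`,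

where `H̃∞(W|I) = −log E_i[2^{−H∞(W | I = i)}]` is the average min-entropy (ibid., §2.4), with the printed
proof: "Let `W_i = (W | I = i)`. Then `SD(…) = E_i[SD((H_X(W_i), X), (U_ℓ, X))] ≤ ½ E_i[√(2^{−H∞(W_i)} 2^ℓ)]
≤ ½ √(E_i[2^{−H∞(W_i)} 2^ℓ])` … the first inequality follows from the standard Leftover Hash Lemma, and
the second inequality follows from Jensen's inequality". This is the form of the lemma in which the
hashed value carries *side information* — the form consumed by block-wise extraction from next-block
(pseudo)entropy (Haitner–Reingold–Vadhan 2013, §5.3, proof of Lemma 5.4: "with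
`H∞(Y_i | X_{1,…,i−1} = x_{1,…,i−1}) ≥ α` for every `x` … the Leftover Hash Lemma yields that `Z^{[i]}(Y_i)`
has statistical difference at most `2^{−κ/2}` from `Z^{[i−1]}(X_{i−1})`", the side information being the
previous blocks and their hashes) and, after flattening, in the form where the conditional min-entropy
bound holds only outside a set of conditions of small probability.

Rendering, in the counting formalism of the two companions (a source is the image of the uniform
distribution on a nonempty finite set `W` under a map; here the *joint* source `w ↦ (z w, x w)` with side
information `z` and hashed value `x`; the family `(h_k)_{k ∈ K}` pairwise independent on `S ⊇ x(W)` — the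
tree's hypothesis for non-flat sources, `leftoverHash_minEntropy`; it implies universality):

* the conclusion is stated in **test form** — for every `[0,1]`-valued test `F` of (side information,
  key, hash value), `|E[F(z, K, h_K(x))] − E[F(z, K, U_γ)]| ≤ bound` — which is what reductions consume
  (a distinguisher's acceptance probability is such a test) and which sidesteps a general two-distribution
  statistical distance (the right-hand distribution is not uniform: the side information keeps its law);
  the bridge from the companions' `distUnif` to tests is `abs_avg_sub_unifAvg_le_distUnif`
  (`|E_P F − E_U F| ≤ Δ(P, U)` for `0 ≤ F ≤ 1`);
* the average min-entropy enters through a fibre bound `M c` on each slice `W_c = {w : z w = c}`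
  (`|{w ∈ W : z w = c, x w = a}| ≤ M c`), for which `E_c[2^{−H∞(x | z = c)}] ≤ (Σ_c M c)/|W|`:
  `leftoverHash_cond_test` gives `≤ ½ √(|γ| (Σ_{c ∈ z(W)} M c)/|W|)` — exactly the printed chain
  (mixture over slices, `leftoverHash_minEntropy` on each slice, Cauchy–Schwarz for Jensen);
* `leftoverHash_cond_minEntropy_test`: worst-case conditional min-entropy `k` on every slice gives
  `≤ ½ √(|γ|/2ᵏ)` (the HRV form); `leftoverHash_cond_good_test`: min-entropy `k` on the slices of a set
  `Good` gives `≤ ½ √(|γ| (2^{−k} + Pr[z ∉ Good]))`.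

All statements are proved from the companions and Mathlib; no definitions are introduced.

## References

* Y. Dodis, R. Ostrovsky, L. Reyzin, A. Smith, *Fuzzy extractors: how to generate strong keys from
  biometrics and other noisy data*, SIAM J. Comput. 38(1) (2008) 97–139, doi:10.1137/060651380
  (arXiv:cs/0602007), §2.4 (average min-entropy), Lemma 2.2, Lemma 2.4 (generalized LHL) and its proof.
* I. Haitner, O. Reingold, S. Vadhan, *Efficiency improvements in constructing pseudorandom generators
  from one-way functions*, SIAM J. Comput. 42(3) (2013), doi:10.1137/100814421, §5.3, Lemma 5.4 (proof).
* S. Arora, B. Barak, *Computational Complexity: A Modern Approach*, CUP 2009, Lemma 21.26, §21.5.2,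
  Lemma A.21 (statistical distance versus tests).
-/

namespace Literature.Computability.Cryptography

namespace LeftoverHash

open Finset

/-! ### Statistical distance bounds every bounded test -/

section Test

variable {ι β : Type*} [DecidableEq β]

/-- **Distance from uniform bounds every `[0,1]`-valued test**: for `g(S) ⊆ T` and `0 ≤ F ≤ 1`,
`|E[F(g(U_S))] − E[F(U_T)]| ≤ Δ(g(U_S), U_T)` (`= distUnif S g T`). Proof: the difference is
`Σ_v (p_v − 1/|T|) F(v) = Σ_v (p_v − 1/|T|)(F(v) − ½)` since `Σ_v (p_v − 1/|T|) = 0`.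
[Arora–Barak 2009, Lemma A.21 (statistical distance = max advantage of a test), §21.5.2] [folklore] -/
theorem abs_avg_sub_unifAvg_le_distUnif {S : Finset ι} (hS : S.Nonempty) {g : ι → β} {T : Finset β}
    (hT : ∀ x ∈ S, g x ∈ T) (hTne : T.Nonempty) {F : β → ℝ} (hF0 : ∀ v ∈ T, 0 ≤ F v) (hF1 : ∀ v ∈ T, F v ≤ 1) :
    |(∑ x ∈ S, F (g x)) / S.card - (∑ v ∈ T, F v) / T.card| ≤ distUnif S g T := by
  classical
  have hSc : (0 : ℝ) < S.card := by exact_mod_cast hS.card_pos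
  have hTc : (0 : ℝ) < T.card := by exact_mod_cast hTne.card_pos
  -- group the real average by the value of `g`
  have hreal : (∑ x ∈ S, F (g x)) / S.card = ∑ v ∈ T, prob S g v * F v := by
    rw [← Finset.sum_fiberwise_of_maps_to hT (fun x => F (g x)), Finset.sum_div]
    refine Finset.sum_congr rfl fun v _ => ?_
    rw [Finset.sum_congr rfl (g := fun _ => F v) (fun x hx => by rw [(Finset.mem_filter.1 hx).2]),
      Finset.sum_const, nsmul_eq_mul, prob, fib]
    ring
  have hideal : (∑ v ∈ T, F v) / T.card = ∑ v ∈ T, (1 / (T.card : ℝ)) * F v := by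
    rw [Finset.sum_div]
    refine Finset.sum_congr rfl fun v _ => ?_
    ring
  have hzero : ∑ v ∈ T, (prob S g v - 1 / T.card) = 0 := by
    rw [Finset.sum_sub_distrib, sum_prob hS hT, Finset.sum_const, nsmul_eq_mul]
    field_simp
    ring
  have hkey : (∑ x ∈ S, F (g x)) / S.card - (∑ v ∈ T, F v) / T.card =
      ∑ v ∈ T, (prob S g v - 1 / T.card) * (F v - 2⁻¹) := by
    rw [hreal, hideal, ← Finset.sum_sub_distrib]
    have : ∑ v ∈ T, (prob S g v - 1 / T.card) * (F v - 2⁻¹) =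
        ∑ v ∈ T, (prob S g v * F v - 1 / (T.card : ℝ) * F v) - 2⁻¹ * ∑ v ∈ T, (prob S g v - 1 / T.card) := by
      rw [Finset.mul_sum, ← Finset.sum_sub_distrib]
      refine Finset.sum_congr rfl fun v _ => ?_
      ring
    rw [this, hzero, mul_zero, sub_zero]
  rw [hkey, distUnif]
  calc |∑ v ∈ T, (prob S g v - 1 / T.card) * (F v - 2⁻¹)|
      ≤ ∑ v ∈ T, |(prob S g v - 1 / T.card) * (F v - 2⁻¹)| := Finset.abs_sum_le_sum_abs _ _
    _ ≤ ∑ v ∈ T, |prob S g v - 1 / T.card| * 2⁻¹ := by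
        refine Finset.sum_le_sum fun v hv => ?_
        rw [abs_mul]
        refine mul_le_mul_of_nonneg_left ?_ (abs_nonneg _)
        rw [abs_le]
        constructor <;> linarith [hF0 v hv, hF1 v hv]
    _ = 2⁻¹ * ∑ v ∈ T, |prob S g v - 1 / T.card| := by rw [← Finset.sum_mul, mul_comm]

end Test

/-! ### The Leftover Hash Lemma with side information -/

section Conditional

variable {ω ζ α γ κ : Type*} [DecidableEq ζ] [DecidableEq α] [DecidableEq γ] [Fintype γ] [DecidableEq κ]

/-- The slices partition `W`: `Σ_{c ∈ z(W)} |W_c| = |W|`. [folklore] -/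
theorem sum_card_filter_val (W : Finset ω) (z : ω → ζ) : ∑ c ∈ W.image z, (W.filter (fun w => z w = c)).card = W.card := by
  exact (Finset.card_eq_sum_card_fiberwise fun w hw => Finset.mem_image_of_mem z hw).symm

/-- The fibre of `x` inside a slice is the joint fibre `{w ∈ W : z w = c ∧ x w = a}`. [folklore] -/
theorem fib_filter_val (W : Finset ω) (z : ω → ζ) (x : ω → α) (c : ζ) (a : α) :
    fib (W.filter (fun w => z w = c)) x a = W.filter fun w => z w = c ∧ x w = a := by
  unfold fib
  rw [Finset.filter_filter]

variable [Nonempty γ]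

/-- **Generalized Leftover Hash Lemma, test form** (Dodis–Ostrovsky–Reyzin–Smith 2008, Lemma 2.4:
`SD((H_X(W), X, I), (U_ℓ, X, I)) ≤ ½ √(2^{-H̃∞(W|I)} 2^ℓ)`, with the printed proof: condition on the
side information, apply the Leftover Hash Lemma on each slice, and use Jensen's inequality
`E[√Z] ≤ √(E[Z])`). Here the joint source is `w ↦ (z w, x w)`, `w` uniform on `W ≠ ∅` (side
information `z`, hashed value `x`), the family `(h_k)_{k ∈ K}` is pairwise independent on `S ⊇ x(W)`,
and the conditional min-entropy is presented by a fibre bound `M c` on each slice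
(`|{w ∈ W : z w = c, x w = a}| ≤ M c` for all `a`), so that `E_c[2^{-H∞(x | z = c)}] ≤ (Σ_c M c)/|W|`.
For every test `F` of the side information and the pair (key, hash value) with `0 ≤ F ≤ 1`:
`|E[F(z, K, h_K(x))] − E[F(z, K, U_γ)]| ≤ ½ √(|γ| · (Σ_{c ∈ z(W)} M c) / |W|)`.
[cite: DodisEtAl2008, Lemma 2.4] -/
theorem leftoverHash_cond_test [DecidableEq ω] {K : Finset κ} (hKne : K.Nonempty) {h : κ → α → γ} {S : Finset α}
    (hK : IsPairwiseIndep K h S) {W : Finset ω} (hW : W.Nonempty) {z : ω → ζ} {x : ω → α}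
    (hx : ∀ w ∈ W, x w ∈ S) (M : ζ → ℕ) (hM : ∀ c a, (W.filter fun w => z w = c ∧ x w = a).card ≤ M c)
    (F : ζ → κ × γ → ℝ) (hF0 : ∀ c v, 0 ≤ F c v) (hF1 : ∀ c v, F c v ≤ 1) :
    |(∑ k ∈ K, ∑ w ∈ W, F (z w) (k, h k (x w))) / (K.card * W.card) -
        (∑ k ∈ K, ∑ w ∈ W, ∑ u : γ, F (z w) (k, u)) / (K.card * W.card * Fintype.card γ)| ≤
      2⁻¹ * Real.sqrt (Fintype.card γ * (∑ c ∈ W.image z, (M c : ℝ)) / W.card) := by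
  classical
  have hKc : (0 : ℝ) < K.card := by exact_mod_cast hKne.card_pos
  have hWc : (0 : ℝ) < W.card := by exact_mod_cast hW.card_pos
  have hγ : (0 : ℝ) < Fintype.card γ := by exact_mod_cast Fintype.card_pos
  set Z := W.image z with hZ
  have hmaps : ∀ w ∈ W, z w ∈ Z := fun w hw => Finset.mem_image_of_mem z hw
  -- the per-slice averages
  set A : ζ → ℝ := fun c =>
    (∑ p ∈ K ×ˢ W.filter (fun w => z w = c), F c (keyed (fun k w => h k (x w)) p)) / ((K ×ˢ W.filter (fun w => z w = c)).card : ℝ) with hA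
  set B : ζ → ℝ := fun c =>
    (∑ v ∈ K ×ˢ (Finset.univ : Finset γ), F c v) / ((K ×ˢ (Finset.univ : Finset γ)).card : ℝ) with hB
  set p : ζ → ℝ := fun c => ((W.filter (fun w => z w = c)).card : ℝ) / W.card with hp
  -- Step 1: both averages are mixtures over the slices
  have hreal : (∑ k ∈ K, ∑ w ∈ W, F (z w) (k, h k (x w))) / (K.card * W.card) = ∑ c ∈ Z, p c * A c := by
    have h1 : ∑ k ∈ K, ∑ w ∈ W, F (z w) (k, h k (x w)) =
        ∑ c ∈ Z, ∑ k ∈ K, ∑ w ∈ W.filter (fun w => z w = c), F c (k, h k (x w)) := by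
      rw [Finset.sum_comm]
      rw [← Finset.sum_fiberwise_of_maps_to hmaps (fun w => ∑ k ∈ K, F (z w) (k, h k (x w)))]
      refine Finset.sum_congr rfl fun c _ => ?_
      rw [Finset.sum_comm]
      refine Finset.sum_congr rfl fun k _ => Finset.sum_congr rfl fun w hw => ?_
      rw [(Finset.mem_filter.1 hw).2]
    rw [h1, Finset.sum_div]
    refine Finset.sum_congr rfl fun c hc => ?_
    have hsc : (0 : ℝ) < (W.filter (fun w => z w = c)).card := by
      exact_mod_cast (Finset.fiber_nonempty_iff_mem_image.mpr hc).card_pos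
    simp only [hA, hp, Finset.sum_product, keyed, Finset.card_product, Nat.cast_mul]
    field_simp
  have hideal : (∑ k ∈ K, ∑ w ∈ W, ∑ u : γ, F (z w) (k, u)) / (K.card * W.card * Fintype.card γ) =
      ∑ c ∈ Z, p c * B c := by
    have h1 : ∑ k ∈ K, ∑ w ∈ W, ∑ u : γ, F (z w) (k, u) =
        ∑ c ∈ Z, (W.filter (fun w => z w = c)).card * ∑ k ∈ K, ∑ u : γ, F c (k, u) := by
      rw [Finset.sum_comm]
      rw [← Finset.sum_fiberwise_of_maps_to hmaps (fun w => ∑ k ∈ K, ∑ u : γ, F (z w) (k, u))]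
      refine Finset.sum_congr rfl fun c _ => ?_
      rw [Finset.sum_congr rfl (g := fun _ => ∑ k ∈ K, ∑ u : γ, F c (k, u))
        (fun w hw => by rw [(Finset.mem_filter.1 hw).2]), Finset.sum_const, nsmul_eq_mul]
    rw [h1, Finset.sum_div]
    refine Finset.sum_congr rfl fun c _ => ?_
    simp only [hB, hp, Finset.sum_product, Finset.card_product, Finset.card_univ, Nat.cast_mul]
    field_simp
  -- Step 2: on each slice, the Leftover Hash Lemma bounds the test difference
  have hslice : ∀ c ∈ Z, |A c - B c| ≤ 2⁻¹ * Real.sqrt (Fintype.card γ * M c / (W.filter (fun w => z w = c)).card) := by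
    intro c hc
    have hsne : (W.filter (fun w => z w = c)).Nonempty := Finset.fiber_nonempty_iff_mem_image.mpr hc
    have hxs : ∀ w ∈ W.filter (fun w => z w = c), x w ∈ S := fun w hw => hx w (Finset.mem_filter.1 hw).1
    have hT : ∀ q ∈ K ×ˢ W.filter (fun w => z w = c), keyed (fun k w => h k (x w)) q ∈ K ×ˢ (Finset.univ : Finset γ) :=
      fun q hq => Finset.mem_product.2 ⟨(Finset.mem_product.1 hq).1, Finset.mem_univ _⟩
    refine (abs_avg_sub_unifAvg_le_distUnif (hKne.product hsne) hT (hKne.product Finset.univ_nonempty)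
      (fun v _ => hF0 c v) (fun v _ => hF1 c v)).trans ?_
    refine leftoverHash_minEntropy hKne hK hsne hxs (M := M c) fun a => ?_
    rw [fib_filter_val]
    exact hM c a
  -- Step 3: mix and apply Cauchy–Schwarz (Jensen for the square root)
  have hp0 : ∀ c, 0 ≤ p c := fun c => by positivity
  have hpsum : ∑ c ∈ Z, p c = 1 := by
    simp only [hp, ← Finset.sum_div]
    rw [← Nat.cast_sum, sum_card_filter_val, div_self hWc.ne']
  rw [hreal, hideal, ← Finset.sum_sub_distrib]
  calc |∑ c ∈ Z, (p c * A c - p c * B c)|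
      ≤ ∑ c ∈ Z, |p c * A c - p c * B c| := Finset.abs_sum_le_sum_abs _ _
    _ ≤ ∑ c ∈ Z, p c * (2⁻¹ * Real.sqrt (Fintype.card γ * M c / (W.filter (fun w => z w = c)).card)) := by
        refine Finset.sum_le_sum fun c hc => ?_
        rw [← mul_sub, abs_mul, abs_of_nonneg (hp0 c)]
        exact mul_le_mul_of_nonneg_left (hslice c hc) (hp0 c)
    _ = 2⁻¹ * ∑ c ∈ Z, Real.sqrt (p c) * Real.sqrt (p c * (Fintype.card γ * M c / (W.filter (fun w => z w = c)).card)) := by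
        rw [Finset.mul_sum]
        refine Finset.sum_congr rfl fun c _ => ?_
        have hsq : Real.sqrt (p c) * Real.sqrt (p c * (Fintype.card γ * M c / (W.filter (fun w => z w = c)).card)) =
            p c * Real.sqrt (Fintype.card γ * M c / (W.filter (fun w => z w = c)).card) := by
          rw [Real.sqrt_mul (hp0 c), ← mul_assoc, Real.mul_self_sqrt (hp0 c)]
        rw [hsq]
        ring
    _ ≤ 2⁻¹ * (Real.sqrt (∑ c ∈ Z, Real.sqrt (p c) ^ 2) *
          Real.sqrt (∑ c ∈ Z, Real.sqrt (p c * (Fintype.card γ * M c / (W.filter (fun w => z w = c)).card)) ^ 2)) := by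
        refine mul_le_mul_of_nonneg_left ?_ (by norm_num)
        exact Real.sum_mul_le_sqrt_mul_sqrt _ _ _
    _ = 2⁻¹ * Real.sqrt (Fintype.card γ * (∑ c ∈ Z, (M c : ℝ)) / W.card) := by
        congr 1
        have h1 : ∑ c ∈ Z, Real.sqrt (p c) ^ 2 = 1 := by
          rw [← hpsum]
          exact Finset.sum_congr rfl fun c _ => Real.sq_sqrt (hp0 c)
        have h2 : ∑ c ∈ Z, Real.sqrt (p c * (Fintype.card γ * M c / (W.filter (fun w => z w = c)).card)) ^ 2 =
            Fintype.card γ * (∑ c ∈ Z, (M c : ℝ)) / W.card := by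
          rw [Finset.mul_sum, Finset.sum_div]
          refine Finset.sum_congr rfl fun c hc => ?_
          have hsc : (0 : ℝ) < (W.filter (fun w => z w = c)).card := by
            exact_mod_cast (Finset.fiber_nonempty_iff_mem_image.mpr hc).card_pos
          rw [Real.sq_sqrt (by positivity)]
          simp only [hp]
          field_simp
        rw [h1, h2, Real.sqrt_one, one_mul]

/-- **Generalized Leftover Hash Lemma for worst-case conditional min-entropy** (the form used in
Haitner–Reingold–Vadhan 2013, §5.3, proof of Lemma 5.4: "with `H∞(Y_i | X_{1,…,i−1} = x_{1,…,i−1}) ≥ α`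
for every `x ∈ Supp(X)` … the Leftover Hash Lemma yields that `Z^{[i]}(Y_i)` has statistical difference
at most `2^{−κ/2}` from `Z^{[i−1]}(X_{i−1})`"): if on every slice the source has min-entropy `k`
(`|{w ∈ W : z w = c, x w = a}| · 2ᵏ ≤ |W_c|`), then for every `[0,1]`-valued test
`|E[F(z, K, h_K(x))] − E[F(z, K, U_γ)]| ≤ ½ √(|γ| / 2ᵏ)`.
[cite: DodisEtAl2008, Lemma 2.4] -/
theorem leftoverHash_cond_minEntropy_test [DecidableEq ω] {K : Finset κ} (hKne : K.Nonempty) {h : κ → α → γ} {S : Finset α}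
    (hK : IsPairwiseIndep K h S) {W : Finset ω} (hW : W.Nonempty) {z : ω → ζ} {x : ω → α}
    (hx : ∀ w ∈ W, x w ∈ S) {k : ℕ}
    (hk : ∀ c a, (W.filter fun w => z w = c ∧ x w = a).card * 2 ^ k ≤ (W.filter (fun w => z w = c)).card)
    (F : ζ → κ × γ → ℝ) (hF0 : ∀ c v, 0 ≤ F c v) (hF1 : ∀ c v, F c v ≤ 1) :
    |(∑ k ∈ K, ∑ w ∈ W, F (z w) (k, h k (x w))) / (K.card * W.card) -
        (∑ k ∈ K, ∑ w ∈ W, ∑ u : γ, F (z w) (k, u)) / (K.card * W.card * Fintype.card γ)| ≤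
      2⁻¹ * Real.sqrt (Fintype.card γ / 2 ^ k) := by
  have hWc : (0 : ℝ) < W.card := by exact_mod_cast hW.card_pos
  refine (leftoverHash_cond_test hKne hK hW hx (fun c => (W.filter (fun w => z w = c)).card / 2 ^ k)
    (fun c a => (Nat.le_div_iff_mul_le (Nat.two_pow_pos k)).2 (hk c a)) F hF0 hF1).trans ?_
  refine mul_le_mul_of_nonneg_left (Real.sqrt_le_sqrt ?_) (by norm_num)
  have hsum : (∑ c ∈ W.image z, (((W.filter (fun w => z w = c)).card / 2 ^ k : ℕ) : ℝ)) ≤ W.card / 2 ^ k := by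
    calc (∑ c ∈ W.image z, (((W.filter (fun w => z w = c)).card / 2 ^ k : ℕ) : ℝ))
        ≤ ∑ c ∈ W.image z, ((W.filter (fun w => z w = c)).card : ℝ) / 2 ^ k :=
          Finset.sum_le_sum fun c _ => by
            have := Nat.cast_div_le (m := (W.filter (fun w => z w = c)).card) (n := 2 ^ k) (α := ℝ)
            simpa using this
      _ = W.card / 2 ^ k := by
          rw [← Finset.sum_div, ← Nat.cast_sum, sum_card_filter_val]
  rw [mul_div_assoc]
  calc (Fintype.card γ : ℝ) * ((∑ c ∈ W.image z, (((W.filter (fun w => z w = c)).card / 2 ^ k : ℕ) : ℝ)) / W.card)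
      ≤ Fintype.card γ * ((W.card / 2 ^ k) / W.card) := by
        refine mul_le_mul_of_nonneg_left (div_le_div_of_nonneg_right hsum hWc.le) (Nat.cast_nonneg _)
    _ = Fintype.card γ / 2 ^ k := by field_simp

/-- **Generalized Leftover Hash Lemma with a good set of side-information values** (the form
consumed after flattening, where conditional min-entropy `k` holds only outside a set of slices of
small probability): if the fibre bound `· 2ᵏ ≤ |W_c|` holds for every `c ∈ Good`, then for every
`[0,1]`-valued test
`|E[F(z, K, h_K(x))] − E[F(z, K, U_γ)]| ≤ ½ √(|γ| · (2^{−k} + Pr_w[z w ∉ Good]))`.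
[Dodis–Ostrovsky–Reyzin–Smith 2008, Lemma 2.4 with Lemma 2.2(a)] [cite: DodisEtAl2008, Lemma 2.4] -/
theorem leftoverHash_cond_good_test [DecidableEq ω] {K : Finset κ} (hKne : K.Nonempty) {h : κ → α → γ} {S : Finset α}
    (hK : IsPairwiseIndep K h S) {W : Finset ω} (hW : W.Nonempty) {z : ω → ζ} {x : ω → α}
    (hx : ∀ w ∈ W, x w ∈ S) {k : ℕ} (Good : Finset ζ)
    (hk : ∀ c ∈ Good, ∀ a, (W.filter fun w => z w = c ∧ x w = a).card * 2 ^ k ≤ (W.filter (fun w => z w = c)).card)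
    (F : ζ → κ × γ → ℝ) (hF0 : ∀ c v, 0 ≤ F c v) (hF1 : ∀ c v, F c v ≤ 1) :
    |(∑ k ∈ K, ∑ w ∈ W, F (z w) (k, h k (x w))) / (K.card * W.card) -
        (∑ k ∈ K, ∑ w ∈ W, ∑ u : γ, F (z w) (k, u)) / (K.card * W.card * Fintype.card γ)| ≤
      2⁻¹ * Real.sqrt (Fintype.card γ * (1 / 2 ^ k + ((W.filter fun w => z w ∉ Good).card : ℝ) / W.card)) := by
  classical
  have hWc : (0 : ℝ) < W.card := by exact_mod_cast hW.card_pos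
  -- the fibre bound: `|W_c| / 2ᵏ` on good slices, `|W_c|` on bad ones
  set M : ζ → ℕ := fun c => if c ∈ Good then (W.filter (fun w => z w = c)).card / 2 ^ k else (W.filter (fun w => z w = c)).card with hMdef
  have hM : ∀ c a, (W.filter fun w => z w = c ∧ x w = a).card ≤ M c := by
    intro c a
    simp only [hMdef]
    split_ifs with hc
    · exact (Nat.le_div_iff_mul_le (Nat.two_pow_pos k)).2 (hk c hc a)
    · rw [← fib_filter_val]
      exact Finset.card_filter_le _ _
  refine (leftoverHash_cond_test hKne hK hW hx M hM F hF0 hF1).trans ?_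
  refine mul_le_mul_of_nonneg_left (Real.sqrt_le_sqrt ?_) (by norm_num)
  -- `Σ_c M c ≤ |W|/2ᵏ + |W_bad|`
  have hbad : ∑ c ∈ (W.image z).filter (fun c => c ∉ Good), ((W.filter (fun w => z w = c)).card : ℝ) =
      ((W.filter fun w => z w ∉ Good).card : ℝ) := by
    rw [← Nat.cast_sum]
    congr 1
    rw [Finset.card_eq_sum_card_fiberwise (f := z) (t := (W.image z).filter fun c => c ∉ Good)
      (fun w hw => Finset.mem_filter.2 ⟨Finset.mem_image_of_mem z (Finset.mem_filter.1 hw).1, (Finset.mem_filter.1 hw).2⟩)]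
    refine Finset.sum_congr rfl fun c hc => ?_
    congr 1
    ext w
    simp only [Finset.mem_filter]
    constructor
    · rintro ⟨hw, hwc⟩
      exact ⟨⟨hw, by rw [hwc]; exact (Finset.mem_filter.1 hc).2⟩, hwc⟩
    · rintro ⟨⟨hw, -⟩, hwc⟩
      exact ⟨hw, hwc⟩
  have hsum : (∑ c ∈ W.image z, (M c : ℝ)) ≤ W.card / 2 ^ k + ((W.filter fun w => z w ∉ Good).card : ℝ) := by
    rw [← Finset.sum_filter_add_sum_filter_not (W.image z) (fun c => c ∈ Good)]
    refine add_le_add ?_ ?_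
    · calc ∑ c ∈ (W.image z).filter (fun c => c ∈ Good), (M c : ℝ)
          ≤ ∑ c ∈ (W.image z).filter (fun c => c ∈ Good), ((W.filter (fun w => z w = c)).card : ℝ) / 2 ^ k := by
            refine Finset.sum_le_sum fun c hc => ?_
            have hcg : c ∈ Good := (Finset.mem_filter.1 hc).2
            simp only [hMdef, if_pos hcg]
            have := Nat.cast_div_le (m := (W.filter (fun w => z w = c)).card) (n := 2 ^ k) (α := ℝ)
            simpa using this
        _ ≤ ∑ c ∈ W.image z, ((W.filter (fun w => z w = c)).card : ℝ) / 2 ^ k :=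
            Finset.sum_le_sum_of_subset_of_nonneg (Finset.filter_subset _ _) fun c _ _ => by positivity
        _ = W.card / 2 ^ k := by rw [← Finset.sum_div, ← Nat.cast_sum, sum_card_filter_val]
    · rw [← hbad]
      refine le_of_eq (Finset.sum_congr rfl fun c hc => ?_)
      have hcg : c ∉ Good := (Finset.mem_filter.1 hc).2
      simp only [hMdef, if_neg hcg]
  calc (Fintype.card γ : ℝ) * (∑ c ∈ W.image z, (M c : ℝ)) / W.card
      ≤ Fintype.card γ * (W.card / 2 ^ k + ((W.filter fun w => z w ∉ Good).card : ℝ)) / W.card := by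
        refine div_le_div_of_nonneg_right (mul_le_mul_of_nonneg_left hsum (Nat.cast_nonneg _)) hWc.le
    _ = Fintype.card γ * (1 / 2 ^ k + ((W.filter fun w => z w ∉ Good).card : ℝ) / W.card) := by
        field_simp

end Conditional

end LeftoverHash

end Literature.Computability.Cryptography
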